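import Mathlib
import HarnessLib
import Summits.Langlands.Langlands.Theses.ParityBlindBianchi
import Summits.Langlands.Langlands.Theses.RuelleTorsionArtinWeight
import Summits.Langlands.Langlands.Theorems.ParityBlindBianchiArtinWeightRealisationLevelOddBaseChangeSector
import Summits.Langlands.Langlands.Theorems.ParityBlindBianchiArtinWeightRealisationLevelStubIsIrreducibleTwistIff
import Summits.Langlands.Langlands.Theorems.ParityBlindBianchiArtinWeightRealisationLevelStubFiniteRangeTwist
import Summits.Langlands.Langlands.Theorems.ParityBlindBianchiArtinWeightRealisationLevelStubExistsEventuallySatakeFrobCompatibleAtTwist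

/-!
# The odd-descent-up-to-twist sector of R′ = `ParityBlindBianchi.ArtinWeightRealisationLevel`
(stmt-Langlands-15111) — helper file (`--supports`), line `Sketch`, continuation lead c15

The crux R′ (and the shared crux R = `RuelleTorsionArtinWeight.ArtinWeightRealisation`, item
stmt-Langlands-11057, equivalent to it modulo the twisted Hecke theory of `GL(2)`, p108329/p121004)
asks that a `p`-adically automorphic irreducible finite-image `σ : Γ_K → GL₂(ℚ̄_p)`, `K` imaginary
quadratic, be Satake–Frobenius compatible with a cuspidal `π` of `GL₂(𝔸_K)` at every good place.
Two sectors are closed in the tree without the `p`-adic hypothesis: the SOLVABLE sector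
(`…SolvableSector`, p104572: Langlands–Tunnell) and the ODD BASE-CHANGE sector `σ = ρ|_{Γ_K}`, `ρ`
odd of finite image over `ℚ` (`…OddBaseChangeSector`, p123485, c14: Khare–Wintenberger + Booker +
Arthur–Clozel 4.2 (a)).  This file closes the larger ODD-DESCENT-UP-TO-TWIST sector

  `σ = (ρ|_{Γ_K}) ⊗ ψ`,  `ρ : Γ_ℚ → GL₂(ℚ̄_p)` odd of finite image,  `ψ : Γ_K → ℚ̄_pˣ` continuous
  of finite image (ANY finite-order character of `Γ_K`, not necessarily extending to `Γ_ℚ`),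

modulo the SAME named facts, the new inputs being THEOREMS of the tree: global class field theory
for characters (`artinReciprocity_character_holds`) and the twisting theorem for cuspidal
Borel–Jacquet data (`CuspidalAutomorphicRepData.exists_twist_hecke_hasSatakeParamAt`), assembled in
`stub_exists_eventually_satakeFrobCompatibleAt_twist` (p-id in the ledger; c15): if `π` is compatible
with `σ₀` a.e. then `π ⊗ (ω ∘ det)` is compatible with `σ₀ ⊗ ψ` a.e., `ω` the Hecke character of
`ι ∘ ψ⁻¹`.  The landed rigidity (`satakeFrobCompatibleAt_of_eventually_of_isUnramifiedAt`, Gelbart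
1997 Prop. 4.1 ⇐ JL) upgrades a.e. to every `σ`-unramified place.

Consequence (`artinWeightRealisationLevel_of_residual_twist_sector`): modulo the five theorems in
print LT, KW, Booker, AC 4.2 (a), JL, the open content of R′ — and of R — is the set of `σ` with
insoluble (icosahedral) projective image NO TWIST of which is the restriction of an odd finite-image
representation of `Γ_ℚ`; by Tate's lifting theorem (not used here) these are exactly the `σ` whose
projectivisation either descends to an EVEN `Γ_ℚ → PGL₂(ℂ)` (the route's instance, Calegari 2023
§12) or does not descend to `Γ_ℚ` at all (the genuinely Bianchi icosahedral case).

* `oddBaseChange_sector_subset_oddTwist_sector` — c14's sector is the case `ψ = 1`;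
* `eventually_satakeFrobCompatibleAt_twist_restrictField_of_isOdd` — the sector in the a.e. shape
  of R, displayed hypotheses (odd strong Artin over `ℚ`, `baseChange_cyclic_cuspidal`), no Hecke
  theory;
* `satakeFrobCompatibleAt_twist_restrictField_of_isOdd` (+ Gelbart 4.1 displayed) and
  `…_of_facts` (KW, Booker, AC, JL) — at EVERY unramified place of the twist (shape of R′);
* `artinWeightRealisationLevel_oddTwist_sector` — R′ verbatim on the sector;
* `artinWeightRealisationLevel_of_residual_twist_sector` — LT → KW → Booker → AC → JL →
  R′|{¬ solvable ∧ ¬ odd-twist} → R′;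
* `artinWeightRealisation_oddTwist_sector`, `artinWeightRealisation_of_residual_twist_sector` — the
  same two statements for the SHARED crux R (a.e. conclusion; KW, Booker, AC (+ LT), no Hecke theory).

All registered as stubs on stmt-Langlands-15111.  No definitions, no new named facts.
-/

noncomputable section

open scoped BigOperators Topology Classical Matrix NumberField MatrixGroups
open Literature.NumberTheory.Automorphic Literature.NumberTheory.GaloisRepresentations
  IsDedekindDomain NumberField Filter

-- `Summit.Langlands.Langlands.…`: summit = sub-problem name (D-0017 nested layout), not a typo.
set_option linter.dupNamespace false

namespace Summit.Langlands.Langlands.Theorems.ArtinWeightRealisationLevel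

/-- **c14's odd base-change sector is the case `ψ = 1` of the odd-twist sector**: if `σ = ρ|_{Γ_K}`
with `ρ` odd of finite image then `σ = (ρ|_{Γ_K}) ⊗ 1` (`FramedRep.twist_one`) with the trivial
character of (trivially) finite image. [folklore] -/
theorem oddBaseChange_sector_subset_oddTwist_sector : ∀ (K : Type) [Field K] [NumberField K] (p : ℕ) [Fact p.Prime] (σ : Literature.NumberTheory.GaloisRepresentations.FramedGaloisRep K (PadicAlgCl p) 2), (∃ ρ : Literature.NumberTheory.GaloisRepresentations.FramedGaloisRep ℚ (PadicAlgCl p) 2, Finite ρ.toMonoidHom.range ∧ ρ.IsOdd ∧ ρ.restrictField K = σ) → (∃ (ρ : Literature.NumberTheory.GaloisRepresentations.FramedGaloisRep ℚ (PadicAlgCl p) 2) (ψ : Field.absoluteGaloisGroup K →ₜ* (PadicAlgCl p)ˣ), Finite ρ.toMonoidHom.range ∧ ρ.IsOdd ∧ Finite ψ.toMonoidHom.range ∧ Literature.NumberTheory.GaloisRepresentations.FramedRep.twist (ρ.restrictField K) ψ = σ) := by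
  rintro K _ _ p _ σ ⟨ρ, hfin, hodd, rfl⟩
  refine ⟨ρ, 1, hfin, hodd, ?_, FramedRep.twist_one _⟩
  have h : ((1 : Field.absoluteGaloisGroup K →ₜ* (PadicAlgCl p)ˣ).toMonoidHom.range :
      Set (PadicAlgCl p)ˣ) ⊆ {1} := by
    rintro _ ⟨g, rfl⟩
    exact Set.mem_singleton_iff.mpr rfl
  exact Set.Finite.to_subtype ((Set.finite_singleton _).subset h)

/-- **The odd-twist sector, almost-everywhere form (displayed hypotheses; no Hecke theory).**
Assume odd strong Artin over `ℚ` in Tunnell's a.e. form (`hSA`) and the cuspidality of prime-degree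
cyclic base change (`hBC : baseChange_cyclic_cuspidal`, Arthur–Clozel Thm. 4.2 (a)).  Let `K` be a
quadratic field, `ι : ℚ̄_p ≃+* ℂ`, `ρ : Γ_ℚ → GL₂(ℚ̄_p)` continuous of finite image, ODD, with
`ρ|_{Γ_K}` irreducible, and `ψ : Γ_K → ℚ̄_pˣ` continuous of finite image.  Then some cuspidal `π` of
`GL₂(𝔸_K)` is Satake–Frobenius compatible with `(ρ|_{Γ_K}) ⊗ ψ` at almost every place of `K`:
c14's `eventually_satakeFrobCompatibleAt_restrictField_of_isOdd` gives `π₀` for `ρ|_{Γ_K}`, and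
`stub_exists_eventually_satakeFrobCompatibleAt_twist` (class field theory + twisting of cuspidal data)
twists it. [folklore] -/
theorem eventually_satakeFrobCompatibleAt_twist_restrictField_of_isOdd : (∀ ρ : Literature.NumberTheory.GaloisRepresentations.FramedArtinRep ℚ 2, ρ.toGaloisRep.IsIrreducible → ρ.IsOdd → ∃ (hcpt : Literature.NumberTheory.Automorphic.isCompact_glFiniteIntegralLevel 2 ℚ) (π : Literature.NumberTheory.Automorphic.CuspidalAutomorphicRepData 2 ℚ hcpt), Literature.NumberTheory.Automorphic.IsPiOfArtinRep ρ π.1) → Literature.NumberTheory.Automorphic.baseChange_cyclic_cuspidal → ∀ (K : Type) [Field K] [NumberField K], Module.finrank ℚ K = 2 → ∀ (p : ℕ) [Fact p.Prime] (ι : PadicAlgCl p ≃+* ℂ) (ρ : Literature.NumberTheory.GaloisRepresentations.FramedGaloisRep ℚ (PadicAlgCl p) 2), Finite ρ.toMonoidHom.range → ρ.IsOdd → (ρ.restrictField K).toGaloisRep.IsIrreducible → ∀ ψ : Field.absoluteGaloisGroup K →ₜ* (PadicAlgCl p)ˣ, Finite ψ.toMonoidHom.range → ∃ (hcpt : Literature.NumberTheory.Automorphic.isCompact_glFiniteIntegralLevel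 2 K) (π : Literature.NumberTheory.Automorphic.CuspidalAutomorphicRepData 2 K hcpt), ∀ᶠ w : IsDedekindDomain.HeightOneSpectrum (NumberField.RingOfIntegers K) in Filter.cofinite, Summit.Langlands.SatakeFrobCompatibleAt ι π.1 (Literature.NumberTheory.GaloisRepresentations.FramedRep.twist (ρ.restrictField K) ψ) w := by
  intro hSA hBC K _ _ hK p _ ι ρ hfin hodd hirr ψ hψ
  obtain ⟨hcpt, π₀, hae⟩ :=
    eventually_satakeFrobCompatibleAt_restrictField_of_isOdd hSA hBC K hK p ι ρ hfin hodd hirr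
  obtain ⟨π, hπ⟩ := stub_exists_eventually_satakeFrobCompatibleAt_twist K p ι hcpt π₀
    (ρ.restrictField K) ψ hψ hae
  exact ⟨hcpt, π, hπ⟩

/-- **The odd-twist sector at EVERY unramified place (displayed hypotheses).**  As
`eventually_satakeFrobCompatibleAt_twist_restrictField_of_isOdd`, plus the σ-unramified shadow of
Gelbart 1997 Prop. 4.1 (`hG`, written out): the a.e. compatibility is upgraded to every place where
`(ρ|_{Γ_K}) ⊗ ψ` is unramified by the landed rigidity
`satakeFrobCompatibleAt_of_eventually_of_isUnramifiedAt hG` (the twist has finite image: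
`stub_finite_range_twist`). [folklore] -/
theorem satakeFrobCompatibleAt_twist_restrictField_of_isOdd : (∀ ρ : Literature.NumberTheory.GaloisRepresentations.FramedArtinRep ℚ 2, ρ.toGaloisRep.IsIrreducible → ρ.IsOdd → ∃ (hcpt : Literature.NumberTheory.Automorphic.isCompact_glFiniteIntegralLevel 2 ℚ) (π : Literature.NumberTheory.Automorphic.CuspidalAutomorphicRepData 2 ℚ hcpt), Literature.NumberTheory.Automorphic.IsPiOfArtinRep ρ π.1) → Literature.NumberTheory.Automorphic.baseChange_cyclic_cuspidal → (∀ {F : Type} [Field F] [NumberField F] (hcpt : Literature.NumberTheory.Automorphic.isCompact_glFiniteIntegralLevel 2 F) (σ : Literature.NumberTheory.GaloisRepresentations.FramedArtinRep F 2) (π : Literature.NumberTheory.Automorphic.CuspidalAutomorphicRepData 2 F hcpt), Literature.NumberTheory.Automorphic.IsPiOfArtinRep σ π.1 → ∀ v : IsDedekindDomain.HeightOneSpectrum (NumberField.RingOfIntegers F), σ.IsUnramifiedAt v → Literature.NumberTheory.Automorphic.FrobSatakeCompatibleAt σ π.1 v) → ∀ (K : Type) [Field K] [NumberField K], Module.finrank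 ℚ K = 2 → ∀ (p : ℕ) [Fact p.Prime] (ι : PadicAlgCl p ≃+* ℂ) (ρ : Literature.NumberTheory.GaloisRepresentations.FramedGaloisRep ℚ (PadicAlgCl p) 2), Finite ρ.toMonoidHom.range → ρ.IsOdd → (ρ.restrictField K).toGaloisRep.IsIrreducible → ∀ ψ : Field.absoluteGaloisGroup K →ₜ* (PadicAlgCl p)ˣ, Finite ψ.toMonoidHom.range → ∃ (hcpt : Literature.NumberTheory.Automorphic.isCompact_glFiniteIntegralLevel 2 K) (π : Literature.NumberTheory.Automorphic.CuspidalAutomorphicRepData 2 K hcpt), ∀ w : IsDedekindDomain.HeightOneSpectrum (NumberField.RingOfIntegers K), Literature.NumberTheory.GaloisRepresentations.FramedGaloisRep.IsUnramifiedAt w (Literature.NumberTheory.GaloisRepresentations.FramedRep.twist (ρ.restrictField K) ψ) → Summit.Langlands.SatakeFrobCompatibleAt ι π.1 (Literature.NumberTheory.GaloisRepresentations.FramedRep.twist (ρ.restrictField K) ψ) w := by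
  intro hSA hBC hG K _ _ hK p _ ι ρ hfin hodd hirr ψ hψ
  obtain ⟨hcpt, π, hae⟩ :=
    eventually_satakeFrobCompatibleAt_twist_restrictField_of_isOdd hSA hBC K hK p ι ρ hfin hodd hirr ψ hψ
  have hfinσ : Finite (FramedRep.twist (ρ.restrictField K) ψ).toMonoidHom.range :=
    stub_finite_range_twist K (PadicAlgCl p) 2 (ρ.restrictField K) ψ
      (finite_range_restrictField K ρ hfin) hψ
  exact ⟨hcpt, π, fun w hw => satakeFrobCompatibleAt_of_eventually_of_isUnramifiedAt hG K p ι
    (FramedRep.twist (ρ.restrictField K) ψ) hfinσ hcpt π hae w hw⟩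

/-- **The odd-twist sector from the NAMED facts**: Khare–Wintenberger odd Artin
(`khareWintenberger_artinConjecture_of_isOdd`) + Booker 2003 (`booker_strongArtin_of_artinConjecture`)
(= odd strong Artin over `ℚ`, `strongArtin_ae_of_isOdd`), Arthur–Clozel Thm. 4.2 (a)
(`baseChange_cyclic_cuspidal`) and the twisted Hecke theory of `GL(2)`
(`JacquetLanglands1970_twistedHeckeTheoryGL2`, giving Gelbart's Prop. 4.1). [folklore] -/
theorem satakeFrobCompatibleAt_twist_restrictField_of_isOdd_of_facts : Literature.NumberTheory.Automorphic.khareWintenberger_artinConjecture_of_isOdd → Literature.NumberTheory.Automorphic.booker_strongArtin_of_artinConjecture → Literature.NumberTheory.Automorphic.baseChange_cyclic_cuspidal → Literature.NumberTheory.Automorphic.JacquetLanglands1970_twistedHeckeTheoryGL2 → ∀ (K : Type) [Field K] [NumberField K], Module.finrank ℚ K = 2 → ∀ (p : ℕ) [Fact p.Prime] (ι : PadicAlgCl p ≃+* ℂ) (ρ : Literature.NumberTheory.GaloisRepresentations.FramedGaloisRep ℚ (PadicAlgCl p) 2), Finite ρ.toMonoidHom.range → ρ.IsOdd → (ρ.restrictField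 K).toGaloisRep.IsIrreducible → ∀ ψ : Field.absoluteGaloisGroup K →ₜ* (PadicAlgCl p)ˣ, Finite ψ.toMonoidHom.range → ∃ (hcpt : Literature.NumberTheory.Automorphic.isCompact_glFiniteIntegralLevel 2 K) (π : Literature.NumberTheory.Automorphic.CuspidalAutomorphicRepData 2 K hcpt), ∀ w : IsDedekindDomain.HeightOneSpectrum (NumberField.RingOfIntegers K), Literature.NumberTheory.GaloisRepresentations.FramedGaloisRep.IsUnramifiedAt w (Literature.NumberTheory.GaloisRepresentations.FramedRep.twist (ρ.restrictField K) ψ) → Summit.Langlands.SatakeFrobCompatibleAt ι π.1 (Literature.NumberTheory.GaloisRepresentations.FramedRep.twist (ρ.restrictField K) ψ) w := by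
  intro hKW hB hBC hJL K _ _ hK p _ ι ρ hfin hodd hirr ψ hψ
  have hG : frobSatakeCompatibleAt_of_isPiOfArtinRep_of_isUnramifiedAt :=
    frobSatakeCompatibleAt_of_isPiOfArtinRep_of_isUnramifiedAt_of_JacquetLanglands1970_twistedHeckeTheoryGL2 hJL
  exact satakeFrobCompatibleAt_twist_restrictField_of_isOdd
    (fun τ hirr hodd => strongArtin_ae_of_isOdd hKW hB τ hirr hodd) hBC
    (fun hcpt τ π hπ v hv => hG hcpt τ π hπ v hv) K hK p ι ρ hfin hodd hirr ψ hψ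

/-- **R′ on the odd-twist sector**: the crux `ParityBlindBianchi.ArtinWeightRealisationLevel`
restricted to the `σ : Γ_K → GL₂(ℚ̄_p)` of the form `(ρ|_{Γ_K}) ⊗ ψ` (`ρ` odd of finite image over
`ℚ`, `ψ` a continuous character of `Γ_K` of finite image) holds modulo the four named facts (KW odd
Artin, Booker, Arthur–Clozel 4.2 (a), JL): irreducibility passes from `σ` to `ρ|_{Γ_K}`
(`stub_isIrreducible_twist_iff`), and the `p`-adic automorphy hypothesis is used only through
`IsHeckeAssociatedAt.isUnramifiedAt` (σ is unramified at every good place). [folklore] -/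
theorem artinWeightRealisationLevel_oddTwist_sector : Literature.NumberTheory.Automorphic.khareWintenberger_artinConjecture_of_isOdd → Literature.NumberTheory.Automorphic.booker_strongArtin_of_artinConjecture → Literature.NumberTheory.Automorphic.baseChange_cyclic_cuspidal → Literature.NumberTheory.Automorphic.JacquetLanglands1970_twistedHeckeTheoryGL2 → ∀ (K : Type) [Field K] [NumberField K], NumberField.IsTotallyComplex K → Module.finrank ℚ K = 2 → ∀ (p : ℕ) [Fact p.Prime] (ι : PadicAlgCl p ≃+* ℂ) (σ : Literature.NumberTheory.GaloisRepresentations.FramedGaloisRep K (PadicAlgCl p) 2), Finite σ.toMonoidHom.range → σ.toGaloisRep.IsIrreducible → (∃ (ρ : Literature.NumberTheory.GaloisRepresentations.FramedGaloisRep ℚ (PadicAlgCl p) 2) (ψ : Field.absoluteGaloisGroup K →ₜ* (PadicAlgCl p)ˣ), Finite ρ.toMonoidHom.range ∧ ρ.IsOdd ∧ Finite ψ.toMonoidHom.range ∧ Literature.NumberTheory.GaloisRepresentations.FramedRep.twist (ρ.restrictField K) ψ = σ) → ∀ S₀ : Finset ℕ, p ∈ S₀ → (∃ (U : Subgroup (GL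 (Fin 2) (IsDedekindDomain.FiniteAdeleRing (NumberField.RingOfIntegers K) K))) (ϖ : ∀ v : IsDedekindDomain.HeightOneSpectrum (NumberField.RingOfIntegers K), (v.adicCompletion K)ˣ) (a : {v : IsDedekindDomain.HeightOneSpectrum (NumberField.RingOfIntegers K) // ∀ ℓ ∈ S₀, ((ℓ : ℕ) : NumberField.RingOfIntegers K) ∉ v.asIdeal} → ℕ → (Valued.v (R := PadicAlgCl p)).valuationSubring), IsOpen (U : Set (GL (Fin 2) (IsDedekindDomain.FiniteAdeleRing (NumberField.RingOfIntegers K) K))) ∧ U ≤ Literature.NumberTheory.Automorphic.glFiniteIntegralLevel 2 K ∧ (∀ g ∈ Literature.NumberTheory.Automorphic.glFiniteIntegralLevel 2 K, (∀ v : IsDedekindDomain.HeightOneSpectrum (NumberField.RingOfIntegers K), ¬ (∀ ℓ ∈ S₀, ((ℓ : ℕ) : NumberField.RingOfIntegers K) ∉ v.asIdeal) → ∀ i j : Fin 2, ((g : Matrix (Fin 2) (Fin 2) (IsDedekindDomain.FiniteAdeleRing (NumberField.RingOfIntegers K) K)) i j) v = (1 : Matrix (Fin 2) (Fin 2) (v.adicCompletion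 K)) i j) → g ∈ U) ∧ (∀ v : IsDedekindDomain.HeightOneSpectrum (NumberField.RingOfIntegers K), Valued.v ((ϖ v : (v.adicCompletion K)ˣ) : v.adicCompletion K) = WithZero.exp (-1 : ℤ)) ∧ Literature.NumberTheory.Automorphic.IsHeckePoint (Matrix.GeneralLinearGroup.map (n := Fin 2) (algebraMap K (IsDedekindDomain.FiniteAdeleRing (NumberField.RingOfIntegers K) K))) (Literature.NumberTheory.Automorphic.LevelTower.ofSeq U (fun r : ℕ => (Literature.NumberTheory.Automorphic.principalCongruenceLevel 2 K (Ideal.span {((p : ℕ) : NumberField.RingOfIntegers K)} ^ r)).map (Literature.NumberTheory.Automorphic.GLn.sndHom 2 K))) ((p : ℕ) : (Valued.v (R := PadicAlgCl p)).valuationSubring) (fun j : {v : IsDedekindDomain.HeightOneSpectrum (NumberField.RingOfIntegers K) // ∀ ℓ ∈ S₀, ((ℓ : ℕ) : NumberField.RingOfIntegers K) ∉ v.asIdeal} × Fin 2 => Literature.NumberTheory.Automorphic.GLn.sndHom 2 K (Literature.NumberTheory.Automorphic.heckeDiagAt 2 K j.1.1 (ϖ j.1.1) (j.2.val + 1)))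 (fun j => a j.1 (j.2.val + 1)) ∧ ∀ (v : IsDedekindDomain.HeightOneSpectrum (NumberField.RingOfIntegers K)) (hv : ∀ ℓ ∈ S₀, ((ℓ : ℕ) : NumberField.RingOfIntegers K) ∉ v.asIdeal), σ.IsHeckeAssociatedAt v (fun i : ℕ => if i = 0 then (1 : PadicAlgCl p) else ((a ⟨v, hv⟩ i : (Valued.v (R := PadicAlgCl p)).valuationSubring) : PadicAlgCl p))) → ∃ (hcpt : Literature.NumberTheory.Automorphic.isCompact_glFiniteIntegralLevel 2 K) (π : Literature.NumberTheory.Automorphic.CuspidalAutomorphicRepData 2 K hcpt), ∀ w : IsDedekindDomain.HeightOneSpectrum (NumberField.RingOfIntegers K), (∀ ℓ ∈ S₀, ((ℓ : ℕ) : NumberField.RingOfIntegers K) ∉ w.asIdeal) → Summit.Langlands.SatakeFrobCompatibleAt ι π.1 σ w := by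
  intro hKW hB hBC hJL K _ _ _ hdeg p _ ι σ _ hirr hsec S₀ _ hyp
  obtain ⟨ρ, ψ, hfinρ, hodd, hψ, rfl⟩ := hsec
  have hirr₀ : (ρ.restrictField K).toGaloisRep.IsIrreducible :=
    (stub_isIrreducible_twist_iff K (PadicAlgCl p) 2 (ρ.restrictField K) ψ).1 hirr
  obtain ⟨hcpt, π, hπ⟩ := satakeFrobCompatibleAt_twist_restrictField_of_isOdd_of_facts hKW hB hBC hJL K hdeg
    p ι ρ hfinρ hodd hirr₀ ψ hψ
  refine ⟨hcpt, π, fun w hw => hπ w ?_⟩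
  obtain ⟨U, ϖ, a, -, -, -, -, -, hassoc⟩ := hyp
  exact (hassoc w hw).isUnramifiedAt

/-- **The open residue of R′ is the non-solvable, non-odd-twist sector.**  Modulo the five named
facts — Langlands–Tunnell (`strongArtin_of_isSolvable`), Khare–Wintenberger odd Artin, Booker,
Arthur–Clozel 4.2 (a), JL — the crux follows from its restriction to the `σ` with INSOLUBLE
(icosahedral) projective image NO TWIST of which is the restriction to `Γ_K` of an odd finite-image
representation of `Γ_ℚ` (i.e. `σ ≠ (ρ|_{Γ_K}) ⊗ ψ` for all such `ρ`, `ψ`): the even-descent sector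
consumed by the route `ParityBlindBianchi` (`σ = ρ|_{Γ_K}`, `ρ` EVEN icosahedral) together with the
non-descending icosahedral `σ`. [folklore] -/
theorem artinWeightRealisationLevel_of_residual_twist_sector : Literature.NumberTheory.Automorphic.strongArtin_of_isSolvable → Literature.NumberTheory.Automorphic.khareWintenberger_artinConjecture_of_isOdd → Literature.NumberTheory.Automorphic.booker_strongArtin_of_artinConjecture → Literature.NumberTheory.Automorphic.baseChange_cyclic_cuspidal → Literature.NumberTheory.Automorphic.JacquetLanglands1970_twistedHeckeTheoryGL2 → (∀ (K : Type) [Field K] [NumberField K], NumberField.IsTotallyComplex K → Module.finrank ℚ K = 2 → ∀ (p : ℕ) [Fact p.Prime] (ι : PadicAlgCl p ≃+* ℂ) (σ : Literature.NumberTheory.GaloisRepresentations.FramedGaloisRep K (PadicAlgCl p) 2), Finite σ.toMonoidHom.range → σ.toGaloisRep.IsIrreducible → ¬ IsSolvable (Literature.NumberTheory.GaloisRepresentations.projectiveImage σ.toMonoidHom) → ¬ (∃ (ρ : Literature.NumberTheory.GaloisRepresentations.FramedGaloisRep ℚ (PadicAlgCl p) 2) (ψ : Field.absoluteGaloisGroup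 K →ₜ* (PadicAlgCl p)ˣ), Finite ρ.toMonoidHom.range ∧ ρ.IsOdd ∧ Finite ψ.toMonoidHom.range ∧ Literature.NumberTheory.GaloisRepresentations.FramedRep.twist (ρ.restrictField K) ψ = σ) → ∀ S₀ : Finset ℕ, p ∈ S₀ → (∃ (U : Subgroup (GL (Fin 2) (IsDedekindDomain.FiniteAdeleRing (NumberField.RingOfIntegers K) K))) (ϖ : ∀ v : IsDedekindDomain.HeightOneSpectrum (NumberField.RingOfIntegers K), (v.adicCompletion K)ˣ) (a : {v : IsDedekindDomain.HeightOneSpectrum (NumberField.RingOfIntegers K) // ∀ ℓ ∈ S₀, ((ℓ : ℕ) : NumberField.RingOfIntegers K) ∉ v.asIdeal} → ℕ → (Valued.v (R := PadicAlgCl p)).valuationSubring), IsOpen (U : Set (GL (Fin 2) (IsDedekindDomain.FiniteAdeleRing (NumberField.RingOfIntegers K) K))) ∧ U ≤ Literature.NumberTheory.Automorphic.glFiniteIntegralLevel 2 K ∧ (∀ g ∈ Literature.NumberTheory.Automorphic.glFiniteIntegralLevel 2 K, (∀ v : IsDedekindDomain.HeightOneSpectrum (NumberField.RingOfIntegers K),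 ¬ (∀ ℓ ∈ S₀, ((ℓ : ℕ) : NumberField.RingOfIntegers K) ∉ v.asIdeal) → ∀ i j : Fin 2, ((g : Matrix (Fin 2) (Fin 2) (IsDedekindDomain.FiniteAdeleRing (NumberField.RingOfIntegers K) K)) i j) v = (1 : Matrix (Fin 2) (Fin 2) (v.adicCompletion K)) i j) → g ∈ U) ∧ (∀ v : IsDedekindDomain.HeightOneSpectrum (NumberField.RingOfIntegers K), Valued.v ((ϖ v : (v.adicCompletion K)ˣ) : v.adicCompletion K) = WithZero.exp (-1 : ℤ)) ∧ Literature.NumberTheory.Automorphic.IsHeckePoint (Matrix.GeneralLinearGroup.map (n := Fin 2) (algebraMap K (IsDedekindDomain.FiniteAdeleRing (NumberField.RingOfIntegers K) K))) (Literature.NumberTheory.Automorphic.LevelTower.ofSeq U (fun r : ℕ => (Literature.NumberTheory.Automorphic.principalCongruenceLevel 2 K (Ideal.span {((p : ℕ) : NumberField.RingOfIntegers K)} ^ r)).map (Literature.NumberTheory.Automorphic.GLn.sndHom 2 K))) ((p : ℕ) : (Valued.v (R := PadicAlgCl p)).valuationSubring) (fun j : {v : IsDedekindDomain.HeightOneSpectrum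 (NumberField.RingOfIntegers K) // ∀ ℓ ∈ S₀, ((ℓ : ℕ) : NumberField.RingOfIntegers K) ∉ v.asIdeal} × Fin 2 => Literature.NumberTheory.Automorphic.GLn.sndHom 2 K (Literature.NumberTheory.Automorphic.heckeDiagAt 2 K j.1.1 (ϖ j.1.1) (j.2.val + 1))) (fun j => a j.1 (j.2.val + 1)) ∧ ∀ (v : IsDedekindDomain.HeightOneSpectrum (NumberField.RingOfIntegers K)) (hv : ∀ ℓ ∈ S₀, ((ℓ : ℕ) : NumberField.RingOfIntegers K) ∉ v.asIdeal), σ.IsHeckeAssociatedAt v (fun i : ℕ => if i = 0 then (1 : PadicAlgCl p) else ((a ⟨v, hv⟩ i : (Valued.v (R := PadicAlgCl p)).valuationSubring) : PadicAlgCl p))) → ∃ (hcpt : Literature.NumberTheory.Automorphic.isCompact_glFiniteIntegralLevel 2 K) (π : Literature.NumberTheory.Automorphic.CuspidalAutomorphicRepData 2 K hcpt), ∀ w : IsDedekindDomain.HeightOneSpectrum (NumberField.RingOfIntegers K), (∀ ℓ ∈ S₀, ((ℓ : ℕ) : NumberField.RingOfIntegers K) ∉ w.asIdeal) → Summit.Langlands.SatakeFrobCompatibleAt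 ι π.1 σ w) → Summit.Langlands.Langlands.Theses.ParityBlindBianchi.ArtinWeightRealisationLevel := by
  intro hLT hKW hB hBC hJL h6
  refine artinWeightRealisationLevel_of_residual_sector hLT hKW hB hBC hJL ?_
  intro K _ _ htc hdeg p _ ι σ hfin hirr hs _ S₀ hp hyp
  exact (Classical.em _).elim
    (fun hsec => artinWeightRealisationLevel_oddTwist_sector hKW hB hBC hJL K htc hdeg p ι σ hfin hirr hsec
      S₀ hp hyp)
    (fun hsec => h6 K htc hdeg p ι σ hfin hirr hs hsec S₀ hp hyp)

/-- **The shared crux R on the odd-twist sector**: `RuelleTorsionArtinWeight.ArtinWeightRealisation`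
(item stmt-Langlands-11057) restricted to the `σ = (ρ|_{Γ_K}) ⊗ ψ` with `ρ` ODD of finite image and
`ψ` of finite image holds modulo the THREE named facts KW odd Artin, Booker, Arthur–Clozel 4.2 (a) —
no Hecke theory of `GL(2)` (the conclusion of R is only a.e.); the `p`-adic automorphy hypothesis of
R is not used at all. [folklore] -/
theorem artinWeightRealisation_oddTwist_sector : Literature.NumberTheory.Automorphic.khareWintenberger_artinConjecture_of_isOdd → Literature.NumberTheory.Automorphic.booker_strongArtin_of_artinConjecture → Literature.NumberTheory.Automorphic.baseChange_cyclic_cuspidal → ∀ (K : Type) [Field K] [NumberField K], NumberField.IsTotallyComplex K → Module.finrank ℚ K = 2 → ∀ (p : ℕ) [Fact p.Prime] (ι : PadicAlgCl p ≃+* ℂ) (σ : Literature.NumberTheory.GaloisRepresentations.FramedGaloisRep K (PadicAlgCl p) 2), Finite σ.toMonoidHom.range → σ.toGaloisRep.IsIrreducible → (∃ (ρ : Literature.NumberTheory.GaloisRepresentations.FramedGaloisRep ℚ (PadicAlgCl p) 2) (ψ : Field.absoluteGaloisGroup K →ₜ* (PadicAlgCl p)ˣ), Finite ρ.toMonoidHom.range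 ∧ ρ.IsOdd ∧ Finite ψ.toMonoidHom.range ∧ Literature.NumberTheory.GaloisRepresentations.FramedRep.twist (ρ.restrictField K) ψ = σ) → (∃ (S : Finset (IsDedekindDomain.HeightOneSpectrum (NumberField.RingOfIntegers K))) (U : Subgroup (GL (Fin 2) (IsDedekindDomain.FiniteAdeleRing (NumberField.RingOfIntegers K) K))) (ϖ : ∀ v : IsDedekindDomain.HeightOneSpectrum (NumberField.RingOfIntegers K), (v.adicCompletion K)ˣ) (a : {v : IsDedekindDomain.HeightOneSpectrum (NumberField.RingOfIntegers K) // v ∉ S} → ℕ → (Valued.v (R := PadicAlgCl p)).valuationSubring), (∀ v : IsDedekindDomain.HeightOneSpectrum (NumberField.RingOfIntegers K), ((p : ℕ) : NumberField.RingOfIntegers K) ∈ v.asIdeal → v ∈ S) ∧ IsOpen (U : Set (GL (Fin 2) (IsDedekindDomain.FiniteAdeleRing (NumberField.RingOfIntegers K) K))) ∧ U ≤ Literature.NumberTheory.Automorphic.glFiniteIntegralLevel 2 K ∧ (∀ g ∈ Literature.NumberTheory.Automorphic.glFiniteIntegralLevel 2 K, (∀ v ∈ S, ∀ i j : Fin 2,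 ((g : Matrix (Fin 2) (Fin 2) (IsDedekindDomain.FiniteAdeleRing (NumberField.RingOfIntegers K) K)) i j) v = (1 : Matrix (Fin 2) (Fin 2) (v.adicCompletion K)) i j) → g ∈ U) ∧ (∀ v : IsDedekindDomain.HeightOneSpectrum (NumberField.RingOfIntegers K), Valued.v ((ϖ v : (v.adicCompletion K)ˣ) : v.adicCompletion K) = WithZero.exp (-1 : ℤ)) ∧ Literature.NumberTheory.Automorphic.IsHeckePoint (Matrix.GeneralLinearGroup.map (n := Fin 2) (algebraMap K (IsDedekindDomain.FiniteAdeleRing (NumberField.RingOfIntegers K) K))) (Literature.NumberTheory.Automorphic.LevelTower.ofSeq U (fun r : ℕ => (Literature.NumberTheory.Automorphic.principalCongruenceLevel 2 K (Ideal.span {((p : ℕ) : NumberField.RingOfIntegers K)} ^ r)).map (Literature.NumberTheory.Automorphic.GLn.sndHom 2 K))) ((p : ℕ) : (Valued.v (R := PadicAlgCl p)).valuationSubring) (fun j : {v : IsDedekindDomain.HeightOneSpectrum (NumberField.RingOfIntegers K) // v ∉ S} × Fin 2 => Literature.NumberTheory.Automorphic.GLn.sndHom 2 K (Literature.NumberTheory.Automorphic.heckeDiagAt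 2 K j.1.1 (ϖ j.1.1) (j.2.val + 1))) (fun j => a j.1 (j.2.val + 1)) ∧ ∀ (v : IsDedekindDomain.HeightOneSpectrum (NumberField.RingOfIntegers K)) (hv : v ∉ S), σ.IsHeckeAssociatedAt v (fun i : ℕ => if i = 0 then (1 : PadicAlgCl p) else ((a ⟨v, hv⟩ i : (Valued.v (R := PadicAlgCl p)).valuationSubring) : PadicAlgCl p))) → ∃ (hcpt : Literature.NumberTheory.Automorphic.isCompact_glFiniteIntegralLevel 2 K) (π : Literature.NumberTheory.Automorphic.CuspidalAutomorphicRepData 2 K hcpt), ∀ᶠ w : IsDedekindDomain.HeightOneSpectrum (NumberField.RingOfIntegers K) in Filter.cofinite, Summit.Langlands.SatakeFrobCompatibleAt ι π.1 σ w := by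
  intro hKW hB hBC K _ _ _ hdeg p _ ι σ _ hirr hsec _
  obtain ⟨ρ, ψ, hfinρ, hodd, hψ, rfl⟩ := hsec
  have hirr₀ : (ρ.restrictField K).toGaloisRep.IsIrreducible :=
    (stub_isIrreducible_twist_iff K (PadicAlgCl p) 2 (ρ.restrictField K) ψ).1 hirr
  exact eventually_satakeFrobCompatibleAt_twist_restrictField_of_isOdd
    (fun τ hirr hodd => strongArtin_ae_of_isOdd hKW hB τ hirr hodd) hBC K hdeg p ι ρ hfinρ hodd hirr₀ ψ hψ

/-- **The open residue of the shared crux R**: modulo Langlands–Tunnell, KW odd Artin, Booker and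
Arthur–Clozel 4.2 (a) — four named facts, no Hecke theory — `RuelleTorsionArtinWeight.ArtinWeightRealisation`
follows from its restriction to the `σ` with insoluble projective image no twist of which is the
restriction to `Γ_K` of an odd finite-image representation of `Γ_ℚ`. [folklore] -/
theorem artinWeightRealisation_of_residual_twist_sector : Literature.NumberTheory.Automorphic.strongArtin_of_isSolvable → Literature.NumberTheory.Automorphic.khareWintenberger_artinConjecture_of_isOdd → Literature.NumberTheory.Automorphic.booker_strongArtin_of_artinConjecture → Literature.NumberTheory.Automorphic.baseChange_cyclic_cuspidal → (∀ (K : Type) [Field K] [NumberField K], NumberField.IsTotallyComplex K → Module.finrank ℚ K = 2 → ∀ (p : ℕ) [Fact p.Prime] (ι : PadicAlgCl p ≃+* ℂ) (σ : Literature.NumberTheory.GaloisRepresentations.FramedGaloisRep K (PadicAlgCl p) 2), Finite σ.toMonoidHom.range → σ.toGaloisRep.IsIrreducible → ¬ IsSolvable (Literature.NumberTheory.GaloisRepresentations.projectiveImage σ.toMonoidHom) → ¬ (∃ (ρ : Literature.NumberTheory.GaloisRepresentations.FramedGaloisRep ℚ (PadicAlgCl p) 2) (ψ : Field.absoluteGaloisGroup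 K →ₜ* (PadicAlgCl p)ˣ), Finite ρ.toMonoidHom.range ∧ ρ.IsOdd ∧ Finite ψ.toMonoidHom.range ∧ Literature.NumberTheory.GaloisRepresentations.FramedRep.twist (ρ.restrictField K) ψ = σ) → (∃ (S : Finset (IsDedekindDomain.HeightOneSpectrum (NumberField.RingOfIntegers K))) (U : Subgroup (GL (Fin 2) (IsDedekindDomain.FiniteAdeleRing (NumberField.RingOfIntegers K) K))) (ϖ : ∀ v : IsDedekindDomain.HeightOneSpectrum (NumberField.RingOfIntegers K), (v.adicCompletion K)ˣ) (a : {v : IsDedekindDomain.HeightOneSpectrum (NumberField.RingOfIntegers K) // v ∉ S} → ℕ → (Valued.v (R := PadicAlgCl p)).valuationSubring), (∀ v : IsDedekindDomain.HeightOneSpectrum (NumberField.RingOfIntegers K), ((p : ℕ) : NumberField.RingOfIntegers K) ∈ v.asIdeal → v ∈ S) ∧ IsOpen (U : Set (GL (Fin 2) (IsDedekindDomain.FiniteAdeleRing (NumberField.RingOfIntegers K) K))) ∧ U ≤ Literature.NumberTheory.Automorphic.glFiniteIntegralLevel 2 K ∧ (∀ g ∈ Literature.NumberTheory.Automorphic.glFiniteIntegralLevel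 2 K, (∀ v ∈ S, ∀ i j : Fin 2, ((g : Matrix (Fin 2) (Fin 2) (IsDedekindDomain.FiniteAdeleRing (NumberField.RingOfIntegers K) K)) i j) v = (1 : Matrix (Fin 2) (Fin 2) (v.adicCompletion K)) i j) → g ∈ U) ∧ (∀ v : IsDedekindDomain.HeightOneSpectrum (NumberField.RingOfIntegers K), Valued.v ((ϖ v : (v.adicCompletion K)ˣ) : v.adicCompletion K) = WithZero.exp (-1 : ℤ)) ∧ Literature.NumberTheory.Automorphic.IsHeckePoint (Matrix.GeneralLinearGroup.map (n := Fin 2) (algebraMap K (IsDedekindDomain.FiniteAdeleRing (NumberField.RingOfIntegers K) K))) (Literature.NumberTheory.Automorphic.LevelTower.ofSeq U (fun r : ℕ => (Literature.NumberTheory.Automorphic.principalCongruenceLevel 2 K (Ideal.span {((p : ℕ) : NumberField.RingOfIntegers K)} ^ r)).map (Literature.NumberTheory.Automorphic.GLn.sndHom 2 K))) ((p : ℕ) : (Valued.v (R := PadicAlgCl p)).valuationSubring) (fun j : {v : IsDedekindDomain.HeightOneSpectrum (NumberField.RingOfIntegers K) // v ∉ S} × Fin 2 => Literature.NumberTheory.Automorphic.GLn.sndHom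 2 K (Literature.NumberTheory.Automorphic.heckeDiagAt 2 K j.1.1 (ϖ j.1.1) (j.2.val + 1))) (fun j => a j.1 (j.2.val + 1)) ∧ ∀ (v : IsDedekindDomain.HeightOneSpectrum (NumberField.RingOfIntegers K)) (hv : v ∉ S), σ.IsHeckeAssociatedAt v (fun i : ℕ => if i = 0 then (1 : PadicAlgCl p) else ((a ⟨v, hv⟩ i : (Valued.v (R := PadicAlgCl p)).valuationSubring) : PadicAlgCl p))) → ∃ (hcpt : Literature.NumberTheory.Automorphic.isCompact_glFiniteIntegralLevel 2 K) (π : Literature.NumberTheory.Automorphic.CuspidalAutomorphicRepData 2 K hcpt), ∀ᶠ w : IsDedekindDomain.HeightOneSpectrum (NumberField.RingOfIntegers K) in Filter.cofinite, Summit.Langlands.SatakeFrobCompatibleAt ι π.1 σ w) → Summit.Langlands.Langlands.Theses.RuelleTorsionArtinWeight.ArtinWeightRealisation := by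
  intro hLT hKW hB hBC h5
  refine artinWeightRealisation_of_residual_sector hLT hKW hB hBC ?_
  intro K _ _ htc hdeg p _ ι σ hfin hirr hs _ hyp
  exact (Classical.em _).elim
    (fun hsec => artinWeightRealisation_oddTwist_sector hKW hB hBC K htc hdeg p ι σ hfin hirr hsec hyp)
    (fun hsec => h5 K htc hdeg p ι σ hfin hirr hs hsec hyp)

end Summit.Langlands.Langlands.Theorems.ArtinWeightRealisationLevel

end
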